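import Summits.QuantumFields.YangMills.Theorems.ChatterjeeMassGapTorusAxialAdjacentPairSearch
import HarnessLib

/-!
# Crux `NT` (stmt-QuantumFields-19353), strong-coupling rung: the CUBE INCIDENCE package

Helper file of ym-idea-8 (g5, lens "dual"; instrument F4b for the NT non-Gaussian first rung `SkewFloorSU2`,
`Cruxes/NT/Lines/strong_coupling_rung.lean`, LEAD `ym-spine-19353-p1` g17 plan F4).  The third-cumulant jet
`ProductObs.thirdCumulant_sub_leading_le` (`…ProductObsCumulant`) identifies the `β^{#Q₀}` coefficient of
`κ₃^{Λ,β}(φ_p, φ_q, φ_s)` with the Haar integral `∫ ∏_{t ∈ {p,q} ∪ {s} ∪ Q₀} φ_t dν` under four FINITE incidence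
hypotheses (H1), (H2), (H1p), (H1q).  This file discharges them for the unit cube of `ℤ⁴` in directions `0,1,2`
(at `x₃ = 0`): the three observed faces are the mutually adjacent faces based at `e₀, e₁, e₂`,

  `p = (e₀; 1,2)`, `q = (e₁; 0,2)`, `s = (e₂; 0,1)`,   and   `Q₀ = {(0; 1,2), (0; 0,1), (0; 0,2)}`

are the three faces at the origin, so that `{p,q} ∪ {s} ∪ Q₀ = ∂[0,1]³` (the finset of
`StrongCouplingRung.cubeIntegral_centred`).

* `cube_H1` — every family `Q` of at most three plaquettes of `ℤ⁴` other than `Q₀` gives `Q ∪ {s, p, q}` a GOOD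
  private bond (on `s`, on a plaquette of `{p,q} ∖ Q`, or on a plaquette of `Q ∖ {p,q}`).  Case `p, q ∉ Q`: a family
  without private bonds through `p, q, s` of at most six plaquettes is the cube — the search certificate `GS_cube`
  of the S28 device `S28AdjacentPair.exists_mem_subset_of_GS` (fuel `3`, evaluated by the kernel); cases `p ∈ Q` or
  `q ∈ Q`: the two bonds `(e₂, 0)`, `(e₂, 1)` of `s` outside `p ∪ q` force `Q = {·, t₃, t₄}` and then the bond
  `(e₀, 1)` of `p` (resp. `(e₁, 0)` of `q`) cannot be covered (explicit two-bond exclusions through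
  `plaquettesTouching`).
* `cube_H1p`, `cube_H1q` — for `#Q ≤ 2` the face `s` keeps a private bond in `Q ∪ {s, p}` and `Q ∪ {s, q}` (it has
  three bonds outside `p`, resp. `q`, pairwise in no common plaquette other than `s`).
* `cube_H2` — sphere-likeness: every non-empty proper sub-family of the six faces has a private bond (kernel decision
  over the `62` sub-families).

HONEST FRAMING: pure lattice combinatorics of `ℤ⁴`; nothing about Gibbs states, `β`, NT or the gap; SkewFloorSU2 is
NOT proved here; no summit is proved by a line.  References for the role of these families: [cite: Munster1981, §2];
[cite: OsterwalderSeilerAnnPhys1978, §3].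
-/

noncomputable section

open Finset
open Literature.MathematicalPhysics.QuantumLattice (ZdEdge ZdPlaquette plaquetteEdges plaquettesTouching
  mem_plaquettesTouching_iff)
open Summit.QuantumFields.YangMills.Theorems.S28OneBitBox (lt01 lt02 lt12)
open Summit.QuantumFields.YangMills.Theorems.S28AdjacentPair (lt03 lt13 PB_eq_empty_iff exists_mem_subset_of_GS)

namespace Summit.QuantumFields.YangMills.Cruxes.NT.StrongCouplingRung.CubeIncidence

/-! ### Kernel computations -/

/-- The plaquettes of `ℤ⁴` containing the bond `((0,0,1,0), 0)` of `s` (kernel computation). -/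
theorem plaquettesTouching_l3 :
    plaquettesTouching ({((![0,0,1,0] : Fin 4 → ℤ), (0 : Fin 4))} : Finset (ZdEdge 4)) = ({(![0,0,1,0], ⟨(0, 1), lt01⟩), (![0,-1,1,0], ⟨(0, 1), lt01⟩), (![0,0,1,0], ⟨(0, 2), lt02⟩), (![0,0,0,0], ⟨(0, 2), lt02⟩), (![0,0,1,0], ⟨(0, 3), lt03⟩), (![0,0,1,-1], ⟨(0, 3), lt03⟩)} : Finset (ZdPlaquette 4)) := by
  decide +kernel

/-- The plaquettes of `ℤ⁴` containing the bond `((0,0,1,0), 1)` of `s` (kernel computation). -/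
theorem plaquettesTouching_l4 :
    plaquettesTouching ({((![0,0,1,0] : Fin 4 → ℤ), (1 : Fin 4))} : Finset (ZdEdge 4)) = ({(![0,0,1,0], ⟨(0, 1), lt01⟩), (![-1,0,1,0], ⟨(0, 1), lt01⟩), (![0,0,1,0], ⟨(1, 2), lt12⟩), (![0,0,0,0], ⟨(1, 2), lt12⟩), (![0,0,1,0], ⟨(1, 3), lt13⟩), (![0,0,1,-1], ⟨(1, 3), lt13⟩)} : Finset (ZdPlaquette 4)) := by
  decide +kernel

set_option maxRecDepth 1000000 in
/-- Search certificate (S28 device, fuel `3`): every family without private bonds through `s, p, q` of at most six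
plaquettes contains the cube `∂[0,1]³` (kernel computation). -/
theorem GS_cube :
    @Nat.rec (fun _ => Finset (ZdPlaquette 4) → Bool)
        (fun T => if ((T).biUnion plaquetteEdges).filter (fun ℓ => ((T).filter fun p => ℓ ∈ plaquetteEdges p).card = 1) = ∅ then decide (T ∈ ({({(![0,0,0,0], ⟨(1, 2), lt12⟩), (![1,0,0,0], ⟨(1, 2), lt12⟩), (![0,0,0,0], ⟨(0, 1), lt01⟩), (![0,0,1,0], ⟨(0, 1), lt01⟩), (![0,0,0,0], ⟨(0, 2), lt02⟩), (![0,1,0,0], ⟨(0, 2), lt02⟩)} : Finset (ZdPlaquette 4))} : Finset (Finset (ZdPlaquette 4)))) else true)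
        (fun k ih T => if ((T).biUnion plaquetteEdges).filter (fun ℓ => ((T).filter fun p => ℓ ∈ plaquetteEdges p).card = 1) = ∅ then decide (T ∈ ({({(![0,0,0,0], ⟨(1, 2), lt12⟩), (![1,0,0,0], ⟨(1, 2), lt12⟩), (![0,0,0,0], ⟨(0, 1), lt01⟩), (![0,0,1,0], ⟨(0, 1), lt01⟩), (![0,0,0,0], ⟨(0, 2), lt02⟩), (![0,1,0,0], ⟨(0, 2), lt02⟩)} : Finset (ZdPlaquette 4))} : Finset (Finset (ZdPlaquette 4))))
          else decide (4 * (k + 1) < (((T).biUnion plaquetteEdges).filter (fun ℓ => ((T).filter fun p => ℓ ∈ plaquetteEdges p).card = 1)).card) ||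
            decide (∃ ℓ ∈ ((T).biUnion plaquetteEdges).filter (fun ℓ => ((T).filter fun p => ℓ ∈ plaquetteEdges p).card = 1), ∀ p' ∈ plaquettesTouching {ℓ}, p' ∉ T → ih (insert p' T) = true))
        (3) (insert (![0,0,1,0], ⟨(0, 1), lt01⟩) ({(![1,0,0,0], ⟨(1, 2), lt12⟩), (![0,1,0,0], ⟨(0, 2), lt02⟩)} : Finset (ZdPlaquette 4))) = true := by
  decide +kernel

set_option maxRecDepth 1000000 in
/-- Sphere-likeness of the cube, powerset form (kernel decision over the `62` proper non-empty sub-families). -/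
theorem cube_sphere_powerset :
    ∀ S ∈ (({(![1,0,0,0], ⟨(1, 2), lt12⟩), (![0,1,0,0], ⟨(0, 2), lt02⟩)} : Finset (ZdPlaquette 4)) ∪ {(![0,0,1,0], ⟨(0, 1), lt01⟩)} ∪
        ({(![0,0,0,0], ⟨(1, 2), lt12⟩), (![0,0,0,0], ⟨(0, 1), lt01⟩), (![0,0,0,0], ⟨(0, 2), lt02⟩)} : Finset (ZdPlaquette 4))).powerset,
      S.Nonempty → S ≠ ({(![1,0,0,0], ⟨(1, 2), lt12⟩), (![0,1,0,0], ⟨(0, 2), lt02⟩)} : Finset (ZdPlaquette 4)) ∪ {(![0,0,1,0], ⟨(0, 1), lt01⟩)} ∪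
        ({(![0,0,0,0], ⟨(1, 2), lt12⟩), (![0,0,0,0], ⟨(0, 1), lt01⟩), (![0,0,0,0], ⟨(0, 2), lt02⟩)} : Finset (ZdPlaquette 4)) →
      ∃ t ∈ S, ∃ ℓ ∈ plaquetteEdges t, ∀ t' ∈ S, t' ≠ t → ℓ ∉ plaquetteEdges t' := by
  decide +kernel

/-! ### Two-bond exclusions -/

/-- Transport a decidable property over the explicit list of plaquettes containing a bond. -/
theorem forall_of_mem_plaquetteEdges {ℓ : ZdEdge 4} {E : Finset (ZdPlaquette 4)}
    (hE : plaquettesTouching ({ℓ} : Finset (ZdEdge 4)) = E) {P : ZdPlaquette 4 → Prop} (h : ∀ t ∈ E, P t) :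
    ∀ t : ZdPlaquette 4, ℓ ∈ plaquetteEdges t → P t := by
  intro t ht
  apply h
  rw [← hE]
  exact mem_plaquettesTouching_iff.2 ⟨ℓ, Finset.mem_inter.2 ⟨ht, Finset.mem_singleton_self _⟩⟩

/-- The only plaquette containing both `(e₂, 0)` and `(e₂, 1)` is `s`. -/
theorem eq_s_of_l3_l4 : ∀ t : ZdPlaquette 4, ((![0,0,1,0] : Fin 4 → ℤ), (0 : Fin 4)) ∈ plaquetteEdges t →
    ((![0,0,1,0] : Fin 4 → ℤ), (1 : Fin 4)) ∈ plaquetteEdges t → t = (![0,0,1,0], ⟨(0, 1), lt01⟩) :=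
  forall_of_mem_plaquetteEdges plaquettesTouching_l3 (by decide +kernel)

/-- The only plaquette containing both `(e₂, 0)` and `(e₂ + e₀, 1)` is `s`. -/
theorem eq_s_of_l3_a2 : ∀ t : ZdPlaquette 4, ((![0,0,1,0] : Fin 4 → ℤ), (0 : Fin 4)) ∈ plaquetteEdges t →
    ((![1,0,1,0] : Fin 4 → ℤ), (1 : Fin 4)) ∈ plaquetteEdges t → t = (![0,0,1,0], ⟨(0, 1), lt01⟩) :=
  forall_of_mem_plaquetteEdges plaquettesTouching_l3 (by decide +kernel)

/-- The only plaquette containing both `(e₂, 1)` and `(e₂ + e₀, 1)` is `s`. -/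
theorem eq_s_of_l4_a2 : ∀ t : ZdPlaquette 4, ((![0,0,1,0] : Fin 4 → ℤ), (1 : Fin 4)) ∈ plaquetteEdges t →
    ((![1,0,1,0] : Fin 4 → ℤ), (1 : Fin 4)) ∈ plaquetteEdges t → t = (![0,0,1,0], ⟨(0, 1), lt01⟩) :=
  forall_of_mem_plaquetteEdges plaquettesTouching_l4 (by decide +kernel)

/-- The only plaquette containing both `(e₂, 0)` and `(e₂ + e₁, 0)` is `s`. -/
theorem eq_s_of_l3_b2 : ∀ t : ZdPlaquette 4, ((![0,0,1,0] : Fin 4 → ℤ), (0 : Fin 4)) ∈ plaquetteEdges t →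
    ((![0,1,1,0] : Fin 4 → ℤ), (0 : Fin 4)) ∈ plaquetteEdges t → t = (![0,0,1,0], ⟨(0, 1), lt01⟩) :=
  forall_of_mem_plaquetteEdges plaquettesTouching_l3 (by decide +kernel)

/-- The only plaquette containing both `(e₂, 1)` and `(e₂ + e₁, 0)` is `s`. -/
theorem eq_s_of_l4_b2 : ∀ t : ZdPlaquette 4, ((![0,0,1,0] : Fin 4 → ℤ), (1 : Fin 4)) ∈ plaquetteEdges t →
    ((![0,1,1,0] : Fin 4 → ℤ), (0 : Fin 4)) ∈ plaquetteEdges t → t = (![0,0,1,0], ⟨(0, 1), lt01⟩) :=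
  forall_of_mem_plaquetteEdges plaquettesTouching_l4 (by decide +kernel)

/-- No plaquette contains both `(e₂, 0)` and the bond `(e₀, 1)` of `p`. -/
theorem m3_notMem_of_l3 : ∀ t : ZdPlaquette 4, ((![0,0,1,0] : Fin 4 → ℤ), (0 : Fin 4)) ∈ plaquetteEdges t →
    ((![1,0,0,0] : Fin 4 → ℤ), (1 : Fin 4)) ∉ plaquetteEdges t :=
  forall_of_mem_plaquetteEdges plaquettesTouching_l3 (by decide +kernel)

/-- No plaquette contains both `(e₂, 1)` and the bond `(e₀, 1)` of `p`. -/
theorem m3_notMem_of_l4 : ∀ t : ZdPlaquette 4, ((![0,0,1,0] : Fin 4 → ℤ), (1 : Fin 4)) ∈ plaquetteEdges t →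
    ((![1,0,0,0] : Fin 4 → ℤ), (1 : Fin 4)) ∉ plaquetteEdges t :=
  forall_of_mem_plaquetteEdges plaquettesTouching_l4 (by decide +kernel)

/-- No plaquette contains both `(e₂, 0)` and the bond `(e₁, 0)` of `q`. -/
theorem n3_notMem_of_l3 : ∀ t : ZdPlaquette 4, ((![0,0,1,0] : Fin 4 → ℤ), (0 : Fin 4)) ∈ plaquetteEdges t →
    ((![0,1,0,0] : Fin 4 → ℤ), (0 : Fin 4)) ∉ plaquetteEdges t :=
  forall_of_mem_plaquetteEdges plaquettesTouching_l3 (by decide +kernel)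

/-- No plaquette contains both `(e₂, 1)` and the bond `(e₁, 0)` of `q`. -/
theorem n3_notMem_of_l4 : ∀ t : ZdPlaquette 4, ((![0,0,1,0] : Fin 4 → ℤ), (1 : Fin 4)) ∈ plaquetteEdges t →
    ((![0,1,0,0] : Fin 4 → ℤ), (0 : Fin 4)) ∉ plaquetteEdges t :=
  forall_of_mem_plaquetteEdges plaquettesTouching_l4 (by decide +kernel)

/-! ### The incidence hypotheses of the third-cumulant jet for the cube -/

/-- Members of `Q ∪ {s, p, q}` other than `s, p, q` lie in `Q`. -/
theorem mem_of_mem_union_insert {Q : Finset (ZdPlaquette 4)} {t : ZdPlaquette 4}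
    (ht : t ∈ Q ∪ insert (![0,0,1,0], ⟨(0, 1), lt01⟩) ({(![1,0,0,0], ⟨(1, 2), lt12⟩), (![0,1,0,0], ⟨(0, 2), lt02⟩)} : Finset (ZdPlaquette 4)))
    (h1 : t ≠ (![0,0,1,0], ⟨(0, 1), lt01⟩)) (h2 : t ≠ (![1,0,0,0], ⟨(1, 2), lt12⟩)) (h3 : t ≠ (![0,1,0,0], ⟨(0, 2), lt02⟩)) : t ∈ Q := by
  rcases Finset.mem_union.1 ht with h | h
  · exact h
  · simp only [Finset.mem_insert, Finset.mem_singleton] at h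
    rcases h with h | h | h
    · exact absurd h h1
    · exact absurd h h2
    · exact absurd h h3

/-- **(H1) for the cube.** Every family `Q` of at most three plaquettes of `ℤ⁴` other than `Q₀ = {(0;1,2), (0;0,1),
(0;0,2)}` gives the family `Q ∪ {s, p, q}` a good private bond: a bond of `s`, of a plaquette of `{p, q} ∖ Q`, or of
a plaquette of `Q ∖ {p, q}`, contained in no other member. [folklore] -/
theorem cube_H1 (Q : Finset (ZdPlaquette 4)) (hQc : Q.card ≤ 3)
    (hQ : Q ≠ ({(![0,0,0,0], ⟨(1, 2), lt12⟩), (![0,0,0,0], ⟨(0, 1), lt01⟩), (![0,0,0,0], ⟨(0, 2), lt02⟩)} : Finset (ZdPlaquette 4))) :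
    ∃ t ∈ Q ∪ insert (![0,0,1,0], ⟨(0, 1), lt01⟩) ({(![1,0,0,0], ⟨(1, 2), lt12⟩), (![0,1,0,0], ⟨(0, 2), lt02⟩)} : Finset (ZdPlaquette 4)),
      (t ∈ ({(![1,0,0,0], ⟨(1, 2), lt12⟩), (![0,1,0,0], ⟨(0, 2), lt02⟩)} : Finset (ZdPlaquette 4)) → t ∉ Q) ∧ ∃ ℓ ∈ plaquetteEdges t,
        ∀ t' ∈ Q ∪ insert (![0,0,1,0], ⟨(0, 1), lt01⟩) ({(![1,0,0,0], ⟨(1, 2), lt12⟩), (![0,1,0,0], ⟨(0, 2), lt02⟩)} : Finset (ZdPlaquette 4)), t' ≠ t → ℓ ∉ plaquetteEdges t' := by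
  classical
  by_contra H
  push Not at H
  -- the two bonds of `s` outside `p ∪ q` are covered by members `t₃, t₄` of `Q`
  have hsF : (![0,0,1,0], ⟨(0, 1), lt01⟩) ∈ Q ∪ insert (![0,0,1,0], ⟨(0, 1), lt01⟩) ({(![1,0,0,0], ⟨(1, 2), lt12⟩), (![0,1,0,0], ⟨(0, 2), lt02⟩)} : Finset (ZdPlaquette 4)) :=
    Finset.mem_union_right _ (Finset.mem_insert_self _ _)
  have hs_elig : (![0,0,1,0], ⟨(0, 1), lt01⟩) ∈ ({(![1,0,0,0], ⟨(1, 2), lt12⟩), (![0,1,0,0], ⟨(0, 2), lt02⟩)} : Finset (ZdPlaquette 4)) → (![0,0,1,0], ⟨(0, 1), lt01⟩) ∉ Q :=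
    fun h => absurd h (by decide +kernel)
  obtain ⟨t₃, ht₃F, ht₃s, hl3⟩ := H _ hsF hs_elig ((![0,0,1,0] : Fin 4 → ℤ), (0 : Fin 4)) (by decide +kernel)
  obtain ⟨t₄, ht₄F, ht₄s, hl4⟩ := H _ hsF hs_elig ((![0,0,1,0] : Fin 4 → ℤ), (1 : Fin 4)) (by decide +kernel)
  have ht₃p : t₃ ≠ (![1,0,0,0], ⟨(1, 2), lt12⟩) := fun h =>
    (by decide +kernel : ((![0,0,1,0] : Fin 4 → ℤ), (0 : Fin 4)) ∉ plaquetteEdges ((![1,0,0,0], ⟨(1, 2), lt12⟩) : ZdPlaquette 4)) (h ▸ hl3)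
  have ht₃q : t₃ ≠ (![0,1,0,0], ⟨(0, 2), lt02⟩) := fun h =>
    (by decide +kernel : ((![0,0,1,0] : Fin 4 → ℤ), (0 : Fin 4)) ∉ plaquetteEdges ((![0,1,0,0], ⟨(0, 2), lt02⟩) : ZdPlaquette 4)) (h ▸ hl3)
  have ht₄p : t₄ ≠ (![1,0,0,0], ⟨(1, 2), lt12⟩) := fun h =>
    (by decide +kernel : ((![0,0,1,0] : Fin 4 → ℤ), (1 : Fin 4)) ∉ plaquetteEdges ((![1,0,0,0], ⟨(1, 2), lt12⟩) : ZdPlaquette 4)) (h ▸ hl4)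
  have ht₄q : t₄ ≠ (![0,1,0,0], ⟨(0, 2), lt02⟩) := fun h =>
    (by decide +kernel : ((![0,0,1,0] : Fin 4 → ℤ), (1 : Fin 4)) ∉ plaquetteEdges ((![0,1,0,0], ⟨(0, 2), lt02⟩) : ZdPlaquette 4)) (h ▸ hl4)
  have ht₃Q : t₃ ∈ Q := mem_of_mem_union_insert ht₃F ht₃s ht₃p ht₃q
  have ht₄Q : t₄ ∈ Q := mem_of_mem_union_insert ht₄F ht₄s ht₄p ht₄q
  have h34 : t₃ ≠ t₄ := fun h => ht₄s (eq_s_of_l3_l4 t₄ (h ▸ hl3) hl4)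
  have hpq : ((![1,0,0,0], ⟨(1, 2), lt12⟩) : ZdPlaquette 4) ≠ (![0,1,0,0], ⟨(0, 2), lt02⟩) := by decide +kernel
  by_cases hpQ : (![1,0,0,0], ⟨(1, 2), lt12⟩) ∈ Q <;>
    by_cases hqQ : (![0,1,0,0], ⟨(0, 2), lt02⟩) ∈ Q
  · -- `p, q ∈ Q`: four distinct members
    have hsub : insert (![1,0,0,0], ⟨(1, 2), lt12⟩) (insert (![0,1,0,0], ⟨(0, 2), lt02⟩) (insert t₃ ({t₄} : Finset (ZdPlaquette 4)))) ⊆ Q := by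
      intro x hx
      simp only [Finset.mem_insert, Finset.mem_singleton] at hx
      rcases hx with rfl | rfl | rfl | rfl <;> assumption
    have hcard : (insert (![1,0,0,0], ⟨(1, 2), lt12⟩) (insert (![0,1,0,0], ⟨(0, 2), lt02⟩) (insert t₃ ({t₄} : Finset (ZdPlaquette 4))))).card = 4 := by
      rw [Finset.card_insert_of_notMem, Finset.card_insert_of_notMem, Finset.card_insert_of_notMem,
        Finset.card_singleton]
      · simpa using h34
      · simp only [Finset.mem_insert, Finset.mem_singleton, not_or]; exact ⟨ht₃q.symm, ht₄q.symm⟩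
      · simp only [Finset.mem_insert, Finset.mem_singleton, not_or]; exact ⟨hpq, ht₃p.symm, ht₄p.symm⟩
    have := Finset.card_le_card hsub
    omega
  · -- `p ∈ Q`, `q ∉ Q`: `Q = {p, t₃, t₄}` and the bond `(e₁, 0)` of `q` is not covered
    have hsub : insert (![1,0,0,0], ⟨(1, 2), lt12⟩) (insert t₃ ({t₄} : Finset (ZdPlaquette 4))) ⊆ Q := by
      intro x hx
      simp only [Finset.mem_insert, Finset.mem_singleton] at hx
      rcases hx with rfl | rfl | rfl <;> assumption
    have hcard : (insert (![1,0,0,0], ⟨(1, 2), lt12⟩) (insert t₃ ({t₄} : Finset (ZdPlaquette 4)))).card = 3 := by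
      rw [Finset.card_insert_of_notMem, Finset.card_insert_of_notMem, Finset.card_singleton]
      · simpa using h34
      · simp only [Finset.mem_insert, Finset.mem_singleton, not_or]; exact ⟨ht₃p.symm, ht₄p.symm⟩
    have hEq : insert (![1,0,0,0], ⟨(1, 2), lt12⟩) (insert t₃ ({t₄} : Finset (ZdPlaquette 4))) = Q :=
      Finset.eq_of_subset_of_card_le hsub (by omega)
    have hqF : (![0,1,0,0], ⟨(0, 2), lt02⟩) ∈ Q ∪ insert (![0,0,1,0], ⟨(0, 1), lt01⟩) ({(![1,0,0,0], ⟨(1, 2), lt12⟩), (![0,1,0,0], ⟨(0, 2), lt02⟩)} : Finset (ZdPlaquette 4)) :=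
      Finset.mem_union_right _ (by simp)
    obtain ⟨v, hvF, hvq, hn3⟩ := H _ hqF (fun _ => hqQ) ((![0,1,0,0] : Fin 4 → ℤ), (0 : Fin 4)) (by decide +kernel)
    have hvs : v ≠ (![0,0,1,0], ⟨(0, 1), lt01⟩) := fun h =>
      (by decide +kernel : ((![0,1,0,0] : Fin 4 → ℤ), (0 : Fin 4)) ∉ plaquetteEdges ((![0,0,1,0], ⟨(0, 1), lt01⟩) : ZdPlaquette 4)) (h ▸ hn3)
    have hvp : v ≠ (![1,0,0,0], ⟨(1, 2), lt12⟩) := fun h =>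
      (by decide +kernel : ((![0,1,0,0] : Fin 4 → ℤ), (0 : Fin 4)) ∉ plaquetteEdges ((![1,0,0,0], ⟨(1, 2), lt12⟩) : ZdPlaquette 4)) (h ▸ hn3)
    have hvQ : v ∈ Q := mem_of_mem_union_insert hvF hvs hvp hvq
    rw [← hEq] at hvQ
    simp only [Finset.mem_insert, Finset.mem_singleton] at hvQ
    rcases hvQ with h | h | h
    · exact hvp h
    · exact n3_notMem_of_l3 v (h ▸ hl3) hn3
    · exact n3_notMem_of_l4 v (h ▸ hl4) hn3
  · -- `p ∉ Q`, `q ∈ Q`: `Q = {q, t₃, t₄}` and the bond `(e₀, 1)` of `p` is not covered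
    have hsub : insert (![0,1,0,0], ⟨(0, 2), lt02⟩) (insert t₃ ({t₄} : Finset (ZdPlaquette 4))) ⊆ Q := by
      intro x hx
      simp only [Finset.mem_insert, Finset.mem_singleton] at hx
      rcases hx with rfl | rfl | rfl <;> assumption
    have hcard : (insert (![0,1,0,0], ⟨(0, 2), lt02⟩) (insert t₃ ({t₄} : Finset (ZdPlaquette 4)))).card = 3 := by
      rw [Finset.card_insert_of_notMem, Finset.card_insert_of_notMem, Finset.card_singleton]
      · simpa using h34
      · simp only [Finset.mem_insert, Finset.mem_singleton, not_or]; exact ⟨ht₃q.symm, ht₄q.symm⟩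
    have hEq : insert (![0,1,0,0], ⟨(0, 2), lt02⟩) (insert t₃ ({t₄} : Finset (ZdPlaquette 4))) = Q :=
      Finset.eq_of_subset_of_card_le hsub (by omega)
    have hpF : (![1,0,0,0], ⟨(1, 2), lt12⟩) ∈ Q ∪ insert (![0,0,1,0], ⟨(0, 1), lt01⟩) ({(![1,0,0,0], ⟨(1, 2), lt12⟩), (![0,1,0,0], ⟨(0, 2), lt02⟩)} : Finset (ZdPlaquette 4)) :=
      Finset.mem_union_right _ (by simp)
    obtain ⟨u, huF, hup, hm3⟩ := H _ hpF (fun _ => hpQ) ((![1,0,0,0] : Fin 4 → ℤ), (1 : Fin 4)) (by decide +kernel)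
    have hus : u ≠ (![0,0,1,0], ⟨(0, 1), lt01⟩) := fun h =>
      (by decide +kernel : ((![1,0,0,0] : Fin 4 → ℤ), (1 : Fin 4)) ∉ plaquetteEdges ((![0,0,1,0], ⟨(0, 1), lt01⟩) : ZdPlaquette 4)) (h ▸ hm3)
    have huq : u ≠ (![0,1,0,0], ⟨(0, 2), lt02⟩) := fun h =>
      (by decide +kernel : ((![1,0,0,0] : Fin 4 → ℤ), (1 : Fin 4)) ∉ plaquetteEdges ((![0,1,0,0], ⟨(0, 2), lt02⟩) : ZdPlaquette 4)) (h ▸ hm3)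
    have huQ : u ∈ Q := mem_of_mem_union_insert huF hus hup huq
    rw [← hEq] at huQ
    simp only [Finset.mem_insert, Finset.mem_singleton] at huQ
    rcases huQ with h | h | h
    · exact huq h
    · exact m3_notMem_of_l3 u (h ▸ hl3) hm3
    · exact m3_notMem_of_l4 u (h ▸ hl4) hm3
  · -- `p, q ∉ Q`: no private bond at all, so the family is the cube and `Q = Q₀`
    have hN : ∀ t ∈ Q ∪ insert (![0,0,1,0], ⟨(0, 1), lt01⟩) ({(![1,0,0,0], ⟨(1, 2), lt12⟩), (![0,1,0,0], ⟨(0, 2), lt02⟩)} : Finset (ZdPlaquette 4)), ∀ ℓ ∈ plaquetteEdges t,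
        ∃ t' ∈ Q ∪ insert (![0,0,1,0], ⟨(0, 1), lt01⟩) ({(![1,0,0,0], ⟨(1, 2), lt12⟩), (![0,1,0,0], ⟨(0, 2), lt02⟩)} : Finset (ZdPlaquette 4)), t' ≠ t ∧ ℓ ∈ plaquetteEdges t' := by
      intro t ht ℓ hℓ
      refine H t ht ?_ ℓ hℓ
      intro htpq
      simp only [Finset.mem_insert, Finset.mem_singleton] at htpq
      rcases htpq with rfl | rfl
      · exact hpQ
      · exact hqQ
    have hPB := (PB_eq_empty_iff _).2 hN
    have hT₀ : insert (![0,0,1,0], ⟨(0, 1), lt01⟩) ({(![1,0,0,0], ⟨(1, 2), lt12⟩), (![0,1,0,0], ⟨(0, 2), lt02⟩)} : Finset (ZdPlaquette 4)) ⊆ Q ∪ insert (![0,0,1,0], ⟨(0, 1), lt01⟩) ({(![1,0,0,0], ⟨(1, 2), lt12⟩), (![0,1,0,0], ⟨(0, 2), lt02⟩)} : Finset (ZdPlaquette 4)) :=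
      Finset.subset_union_right
    have hT₀card : (insert (![0,0,1,0], ⟨(0, 1), lt01⟩) ({(![1,0,0,0], ⟨(1, 2), lt12⟩), (![0,1,0,0], ⟨(0, 2), lt02⟩)} : Finset (ZdPlaquette 4))).card = 3 := by
      decide +kernel
    have hFcard : (Q ∪ insert (![0,0,1,0], ⟨(0, 1), lt01⟩) ({(![1,0,0,0], ⟨(1, 2), lt12⟩), (![0,1,0,0], ⟨(0, 2), lt02⟩)} : Finset (ZdPlaquette 4))).card ≤ (insert (![0,0,1,0], ⟨(0, 1), lt01⟩) ({(![1,0,0,0], ⟨(1, 2), lt12⟩), (![0,1,0,0], ⟨(0, 2), lt02⟩)} : Finset (ZdPlaquette 4))).card + 3 := by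
      refine (Finset.card_union_le _ _).trans ?_
      rw [hT₀card]; omega
    obtain ⟨B, hB, hBF⟩ := exists_mem_subset_of_GS _ 3 _ GS_cube _ hT₀ hFcard hPB
    rw [Finset.mem_singleton] at hB
    subst hB
    have hQ₀Q : ({(![0,0,0,0], ⟨(1, 2), lt12⟩), (![0,0,0,0], ⟨(0, 1), lt01⟩), (![0,0,0,0], ⟨(0, 2), lt02⟩)} : Finset (ZdPlaquette 4)) ⊆ Q := by
      intro x hx
      have hxC : x ∈ ({(![0,0,0,0], ⟨(1, 2), lt12⟩), (![1,0,0,0], ⟨(1, 2), lt12⟩), (![0,0,0,0], ⟨(0, 1), lt01⟩), (![0,0,1,0], ⟨(0, 1), lt01⟩), (![0,0,0,0], ⟨(0, 2), lt02⟩), (![0,1,0,0], ⟨(0, 2), lt02⟩)} : Finset (ZdPlaquette 4)) :=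
        (by decide +kernel : ({(![0,0,0,0], ⟨(1, 2), lt12⟩), (![0,0,0,0], ⟨(0, 1), lt01⟩), (![0,0,0,0], ⟨(0, 2), lt02⟩)} : Finset (ZdPlaquette 4)) ⊆ ({(![0,0,0,0], ⟨(1, 2), lt12⟩), (![1,0,0,0], ⟨(1, 2), lt12⟩), (![0,0,0,0], ⟨(0, 1), lt01⟩), (![0,0,1,0], ⟨(0, 1), lt01⟩), (![0,0,0,0], ⟨(0, 2), lt02⟩), (![0,1,0,0], ⟨(0, 2), lt02⟩)} : Finset (ZdPlaquette 4))) hx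
      rcases Finset.mem_union.1 (hBF hxC) with h | h
      · exact h
      · exact absurd h ((by decide +kernel : ∀ y ∈ ({(![0,0,0,0], ⟨(1, 2), lt12⟩), (![0,0,0,0], ⟨(0, 1), lt01⟩), (![0,0,0,0], ⟨(0, 2), lt02⟩)} : Finset (ZdPlaquette 4)), y ∉ insert (![0,0,1,0], ⟨(0, 1), lt01⟩) ({(![1,0,0,0], ⟨(1, 2), lt12⟩), (![0,1,0,0], ⟨(0, 2), lt02⟩)} : Finset (ZdPlaquette 4))) x hx)
    have hQ0card : (({(![0,0,0,0], ⟨(1, 2), lt12⟩), (![0,0,0,0], ⟨(0, 1), lt01⟩), (![0,0,0,0], ⟨(0, 2), lt02⟩)} : Finset (ZdPlaquette 4))).card = 3 := by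
      decide +kernel
    exact hQ (Finset.eq_of_subset_of_card_le hQ₀Q (by rw [hQ0card]; exact hQc)).symm

/-- **(H1q) for the cube.** For `#Q ≤ 2` the face `s` has a private bond in `Q ∪ {s, q}`: its three bonds outside `q`
lie pairwise in no common plaquette other than `s`. [folklore] -/
theorem cube_H1q (Q : Finset (ZdPlaquette 4)) (hQc : Q.card < 3) :
    ∃ t ∈ Q ∪ insert (![0,0,1,0], ⟨(0, 1), lt01⟩) ({(![0,1,0,0], ⟨(0, 2), lt02⟩)} : Finset (ZdPlaquette 4)),
      (t ∈ ({(![0,1,0,0], ⟨(0, 2), lt02⟩)} : Finset (ZdPlaquette 4)) → t ∉ Q) ∧ ∃ ℓ ∈ plaquetteEdges t,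
        ∀ t' ∈ Q ∪ insert (![0,0,1,0], ⟨(0, 1), lt01⟩) ({(![0,1,0,0], ⟨(0, 2), lt02⟩)} : Finset (ZdPlaquette 4)), t' ≠ t → ℓ ∉ plaquetteEdges t' := by
  classical
  by_contra H
  push Not at H
  have hsF : (![0,0,1,0], ⟨(0, 1), lt01⟩) ∈ Q ∪ insert (![0,0,1,0], ⟨(0, 1), lt01⟩) ({(![0,1,0,0], ⟨(0, 2), lt02⟩)} : Finset (ZdPlaquette 4)) :=
    Finset.mem_union_right _ (Finset.mem_insert_self _ _)
  have hs_elig : (![0,0,1,0], ⟨(0, 1), lt01⟩) ∈ ({(![0,1,0,0], ⟨(0, 2), lt02⟩)} : Finset (ZdPlaquette 4)) → (![0,0,1,0], ⟨(0, 1), lt01⟩) ∉ Q :=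
    fun h => absurd h (by decide +kernel)
  have memQ : ∀ t ∈ Q ∪ insert (![0,0,1,0], ⟨(0, 1), lt01⟩) ({(![0,1,0,0], ⟨(0, 2), lt02⟩)} : Finset (ZdPlaquette 4)),
      t ≠ (![0,0,1,0], ⟨(0, 1), lt01⟩) → t ≠ (![0,1,0,0], ⟨(0, 2), lt02⟩) → t ∈ Q := by
    intro t ht h1 h2
    rcases Finset.mem_union.1 ht with h | h
    · exact h
    · simp only [Finset.mem_insert, Finset.mem_singleton] at h
      rcases h with h | h
      · exact absurd h h1
      · exact absurd h h2
  obtain ⟨t₃, ht₃F, ht₃s, hl3⟩ := H _ hsF hs_elig ((![0,0,1,0] : Fin 4 → ℤ), (0 : Fin 4)) (by decide +kernel)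
  obtain ⟨tₐ, htₐF, htₐs, ha2⟩ := H _ hsF hs_elig ((![1,0,1,0] : Fin 4 → ℤ), (1 : Fin 4)) (by decide +kernel)
  obtain ⟨t₄, ht₄F, ht₄s, hl4⟩ := H _ hsF hs_elig ((![0,0,1,0] : Fin 4 → ℤ), (1 : Fin 4)) (by decide +kernel)
  have ht₃q : t₃ ≠ (![0,1,0,0], ⟨(0, 2), lt02⟩) := fun h =>
    (by decide +kernel : ((![0,0,1,0] : Fin 4 → ℤ), (0 : Fin 4)) ∉ plaquetteEdges ((![0,1,0,0], ⟨(0, 2), lt02⟩) : ZdPlaquette 4)) (h ▸ hl3)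
  have htₐq : tₐ ≠ (![0,1,0,0], ⟨(0, 2), lt02⟩) := fun h =>
    (by decide +kernel : ((![1,0,1,0] : Fin 4 → ℤ), (1 : Fin 4)) ∉ plaquetteEdges ((![0,1,0,0], ⟨(0, 2), lt02⟩) : ZdPlaquette 4)) (h ▸ ha2)
  have ht₄q : t₄ ≠ (![0,1,0,0], ⟨(0, 2), lt02⟩) := fun h =>
    (by decide +kernel : ((![0,0,1,0] : Fin 4 → ℤ), (1 : Fin 4)) ∉ plaquetteEdges ((![0,1,0,0], ⟨(0, 2), lt02⟩) : ZdPlaquette 4)) (h ▸ hl4)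
  have ht₃Q := memQ t₃ ht₃F ht₃s ht₃q
  have htₐQ := memQ tₐ htₐF htₐs htₐq
  have ht₄Q := memQ t₄ ht₄F ht₄s ht₄q
  have h3a : t₃ ≠ tₐ := fun h => htₐs (eq_s_of_l3_a2 tₐ (h ▸ hl3) ha2)
  have h34 : t₃ ≠ t₄ := fun h => ht₄s (eq_s_of_l3_l4 t₄ (h ▸ hl3) hl4)
  have ha4 : tₐ ≠ t₄ := fun h => htₐs (eq_s_of_l4_a2 tₐ (h ▸ hl4) ha2)
  have hsub : insert t₃ (insert tₐ ({t₄} : Finset (ZdPlaquette 4))) ⊆ Q := by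
    intro x hx
    simp only [Finset.mem_insert, Finset.mem_singleton] at hx
    rcases hx with rfl | rfl | rfl <;> assumption
  have hcard : (insert t₃ (insert tₐ ({t₄} : Finset (ZdPlaquette 4)))).card = 3 := by
    rw [Finset.card_insert_of_notMem, Finset.card_insert_of_notMem, Finset.card_singleton]
    · simpa using ha4
    · simp only [Finset.mem_insert, Finset.mem_singleton, not_or]; exact ⟨h3a, h34⟩
  have := Finset.card_le_card hsub
  omega

/-- **(H1p) for the cube.** For `#Q ≤ 2` the face `s` has a private bond in `Q ∪ {s, p}`: its three bonds outside `p`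
lie pairwise in no common plaquette other than `s`. [folklore] -/
theorem cube_H1p (Q : Finset (ZdPlaquette 4)) (hQc : Q.card < 3) :
    ∃ t ∈ Q ∪ insert (![0,0,1,0], ⟨(0, 1), lt01⟩) ({(![1,0,0,0], ⟨(1, 2), lt12⟩)} : Finset (ZdPlaquette 4)),
      (t ∈ ({(![1,0,0,0], ⟨(1, 2), lt12⟩)} : Finset (ZdPlaquette 4)) → t ∉ Q) ∧ ∃ ℓ ∈ plaquetteEdges t,
        ∀ t' ∈ Q ∪ insert (![0,0,1,0], ⟨(0, 1), lt01⟩) ({(![1,0,0,0], ⟨(1, 2), lt12⟩)} : Finset (ZdPlaquette 4)), t' ≠ t → ℓ ∉ plaquetteEdges t' := by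
  classical
  by_contra H
  push Not at H
  have hsF : (![0,0,1,0], ⟨(0, 1), lt01⟩) ∈ Q ∪ insert (![0,0,1,0], ⟨(0, 1), lt01⟩) ({(![1,0,0,0], ⟨(1, 2), lt12⟩)} : Finset (ZdPlaquette 4)) :=
    Finset.mem_union_right _ (Finset.mem_insert_self _ _)
  have hs_elig : (![0,0,1,0], ⟨(0, 1), lt01⟩) ∈ ({(![1,0,0,0], ⟨(1, 2), lt12⟩)} : Finset (ZdPlaquette 4)) → (![0,0,1,0], ⟨(0, 1), lt01⟩) ∉ Q :=
    fun h => absurd h (by decide +kernel)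
  have memQ : ∀ t ∈ Q ∪ insert (![0,0,1,0], ⟨(0, 1), lt01⟩) ({(![1,0,0,0], ⟨(1, 2), lt12⟩)} : Finset (ZdPlaquette 4)),
      t ≠ (![0,0,1,0], ⟨(0, 1), lt01⟩) → t ≠ (![1,0,0,0], ⟨(1, 2), lt12⟩) → t ∈ Q := by
    intro t ht h1 h2
    rcases Finset.mem_union.1 ht with h | h
    · exact h
    · simp only [Finset.mem_insert, Finset.mem_singleton] at h
      rcases h with h | h
      · exact absurd h h1
      · exact absurd h h2
  obtain ⟨t₃, ht₃F, ht₃s, hl3⟩ := H _ hsF hs_elig ((![0,0,1,0] : Fin 4 → ℤ), (0 : Fin 4)) (by decide +kernel)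
  obtain ⟨t_b, ht_bF, ht_bs, hb2⟩ := H _ hsF hs_elig ((![0,1,1,0] : Fin 4 → ℤ), (0 : Fin 4)) (by decide +kernel)
  obtain ⟨t₄, ht₄F, ht₄s, hl4⟩ := H _ hsF hs_elig ((![0,0,1,0] : Fin 4 → ℤ), (1 : Fin 4)) (by decide +kernel)
  have ht₃p : t₃ ≠ (![1,0,0,0], ⟨(1, 2), lt12⟩) := fun h =>
    (by decide +kernel : ((![0,0,1,0] : Fin 4 → ℤ), (0 : Fin 4)) ∉ plaquetteEdges ((![1,0,0,0], ⟨(1, 2), lt12⟩) : ZdPlaquette 4)) (h ▸ hl3)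
  have ht_bp : t_b ≠ (![1,0,0,0], ⟨(1, 2), lt12⟩) := fun h =>
    (by decide +kernel : ((![0,1,1,0] : Fin 4 → ℤ), (0 : Fin 4)) ∉ plaquetteEdges ((![1,0,0,0], ⟨(1, 2), lt12⟩) : ZdPlaquette 4)) (h ▸ hb2)
  have ht₄p : t₄ ≠ (![1,0,0,0], ⟨(1, 2), lt12⟩) := fun h =>
    (by decide +kernel : ((![0,0,1,0] : Fin 4 → ℤ), (1 : Fin 4)) ∉ plaquetteEdges ((![1,0,0,0], ⟨(1, 2), lt12⟩) : ZdPlaquette 4)) (h ▸ hl4)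
  have ht₃Q := memQ t₃ ht₃F ht₃s ht₃p
  have ht_bQ := memQ t_b ht_bF ht_bs ht_bp
  have ht₄Q := memQ t₄ ht₄F ht₄s ht₄p
  have h3b : t₃ ≠ t_b := fun h => ht_bs (eq_s_of_l3_b2 t_b (h ▸ hl3) hb2)
  have h34 : t₃ ≠ t₄ := fun h => ht₄s (eq_s_of_l3_l4 t₄ (h ▸ hl3) hl4)
  have hb4 : t_b ≠ t₄ := fun h => ht_bs (eq_s_of_l4_b2 t_b (h ▸ hl4) hb2)
  have hsub : insert t₃ (insert t_b ({t₄} : Finset (ZdPlaquette 4))) ⊆ Q := by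
    intro x hx
    simp only [Finset.mem_insert, Finset.mem_singleton] at hx
    rcases hx with rfl | rfl | rfl <;> assumption
  have hcard : (insert t₃ (insert t_b ({t₄} : Finset (ZdPlaquette 4)))).card = 3 := by
    rw [Finset.card_insert_of_notMem, Finset.card_insert_of_notMem, Finset.card_singleton]
    · simpa using hb4
    · simp only [Finset.mem_insert, Finset.mem_singleton, not_or]; exact ⟨h3b, h34⟩
  have := Finset.card_le_card hsub
  omega

/-- **(H2) for the cube** (sphere-likeness): every non-empty proper sub-family of the six faces of `∂[0,1]³` has a
private bond. [folklore] -/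
theorem cube_H2 : ∀ S ⊆ ({(![1,0,0,0], ⟨(1, 2), lt12⟩), (![0,1,0,0], ⟨(0, 2), lt02⟩)} : Finset (ZdPlaquette 4)) ∪ {(![0,0,1,0], ⟨(0, 1), lt01⟩)} ∪
        ({(![0,0,0,0], ⟨(1, 2), lt12⟩), (![0,0,0,0], ⟨(0, 1), lt01⟩), (![0,0,0,0], ⟨(0, 2), lt02⟩)} : Finset (ZdPlaquette 4)),
    S.Nonempty → S ≠ ({(![1,0,0,0], ⟨(1, 2), lt12⟩), (![0,1,0,0], ⟨(0, 2), lt02⟩)} : Finset (ZdPlaquette 4)) ∪ {(![0,0,1,0], ⟨(0, 1), lt01⟩)} ∪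
        ({(![0,0,0,0], ⟨(1, 2), lt12⟩), (![0,0,0,0], ⟨(0, 1), lt01⟩), (![0,0,0,0], ⟨(0, 2), lt02⟩)} : Finset (ZdPlaquette 4)) →
      ∃ t ∈ S, ∃ ℓ ∈ plaquetteEdges t, ∀ t' ∈ S, t' ≠ t → ℓ ∉ plaquetteEdges t' :=
  fun S hS hne hneq => cube_sphere_powerset S (Finset.mem_powerset.2 hS) hne hneq

/-- The six faces `{p, q} ∪ {s} ∪ Q₀` are the cube finset of `StrongCouplingRung.cubeIntegral_centred`. -/
theorem cube_eq : ({(![1,0,0,0], ⟨(1, 2), lt12⟩), (![0,1,0,0], ⟨(0, 2), lt02⟩)} : Finset (ZdPlaquette 4)) ∪ {(![0,0,1,0], ⟨(0, 1), lt01⟩)} ∪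
        ({(![0,0,0,0], ⟨(1, 2), lt12⟩), (![0,0,0,0], ⟨(0, 1), lt01⟩), (![0,0,0,0], ⟨(0, 2), lt02⟩)} : Finset (ZdPlaquette 4)) = ({(![0,0,0,0], ⟨(1, 2), lt12⟩), (![1,0,0,0], ⟨(1, 2), lt12⟩), (![0,0,0,0], ⟨(0, 1), lt01⟩), (![0,0,1,0], ⟨(0, 1), lt01⟩), (![0,0,0,0], ⟨(0, 2), lt02⟩), (![0,1,0,0], ⟨(0, 2), lt02⟩)} : Finset (ZdPlaquette 4)) := by
  decide +kernel

/-- `#Q₀ = 3`. -/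
theorem card_Q0 : (({(![0,0,0,0], ⟨(1, 2), lt12⟩), (![0,0,0,0], ⟨(0, 1), lt01⟩), (![0,0,0,0], ⟨(0, 2), lt02⟩)} : Finset (ZdPlaquette 4))).card = 3 := by
  decide +kernel

end Summit.QuantumFields.YangMills.Cruxes.NT.StrongCouplingRung.CubeIncidence

end
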